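import Summits.Schanuel.Schanuel.Theorems.RootDecomp1EHyperplane01

/-!
# RootDecomp1E · round 14 (lens-2 «structural dichotomy», gen 14) — HYPERPLANE SCHANUEL, part 2 of 2

Continuation of `RootDecomp1EHyperplane01` (§1 exchange lemma, §2 face exchange, §3 `DefectOneSchanuel ↔
HyperplaneSchanuel`, §4 Hermite–Lindemann floor, §4a `DefectOneSchanuel ↔ TwoFaceSchanuel`).  This part: §4b the
first open length `n = 3` unconditionally (pair faces: `two_faces_of_two_le_trdeg`, `defectOneAt_three_iff`,
`triple_demand_iff`, `lw_pair_through`), §4c the exceptional line of a pair-cell family (`lw_exceptional_line`),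
§4d the plain member `(1, π², π³)` decoded (`piPowers_member_decoded`), §5 the route's deciding theorem through `𝓗`
(`closes`).  Source: lens-2 g14 `Hyperplane.lean` (sha256 5feb43ac…) ll. 325–662 verbatim; port
`--supports stmt-Schanuel-25020` (critic g6 cleared LOW).  Sorry-free; standard axioms; nothing here proves
Schanuel (rung 0).
-/

noncomputable section

namespace Summit.Schanuel.Schanuel.Theorems.RootDecomp1EHyperplane

open Complex IntermediateField Polynomial
open Summit.Schanuel.Schanuel.Theses.RootDecomp1E (DefectOneSchanuel PlainDefectOne ClosedFormAtomSchanuel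
  AlgAnchoredDarkAtomSchanuel LineLogDarkAtomSchanuel DeepLogDarkAtomSchanuel OffAxisClosure
  FreeDarkAtomSchanuel)
open Summit.Schanuel.Schanuel.Theorems.RootDecomp1EAnchor (isAlgebraic_of_mem_adjoin
  trdeg_adjoin_le_of_isAlgebraic isAlgebraic_of_trdeg_sandwich exists_nat_lt_of_lt_natCast
  one_le_trdeg_adjoin_singleton trdeg_le_of_mem_span)
open Summit.Schanuel.Schanuel.Theorems.RootDecomp1EEngineType (trdeg_eq_nat
  two_le_trdeg_of_algebraicIndependent_of_isAlgebraic)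
open Literature.NumberTheory.Transcendental (transcendental_exp_holds algebraicIndependent_exp_holds
  transcendental_pi_holds)
open Literature.NumberTheory.Transcendental.OneMotiveToric (trdeg_mono)

/-! ## §4b The first open length `n = 3`, unconditionally: pair faces -/

/-- piece:proved · **TWO SCHANUEL PAIR FACES.** A triple with non-zero coordinates and `trdeg F_z ≥ 2` has,
away from ANY prescribed index `p₀`, a pair face which is a Schanuel pair (`trdeg ≥ 2`); hence at least two
of its three pair faces are Schanuel pairs. Unconditional (H–L floor + face exchange). -/
theorem two_faces_of_two_le_trdeg (z : Fin 3 → ℂ) (hz : ∀ i, z i ≠ 0)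
    (h2 : (2 : Cardinal) ≤ Algebra.trdeg ℚ ↥(adjoin ℚ (Set.range z ∪ Set.range (cexp ∘ z))))
    (p₀ : Fin 3) :
    ∃ p : Fin 3, p ≠ p₀ ∧ (2 : Cardinal) ≤
      Algebra.trdeg ℚ ↥(adjoin ℚ (Set.range (z ∘ p.succAbove) ∪ Set.range (cexp ∘ (z ∘ p.succAbove)))) := by
  have key : ∀ (p : Fin 3) (q : Fin 2),
      (2 : Cardinal) ≤ Algebra.trdeg ℚ ↥(adjoin ℚ
          (Set.range (z ∘ p.succAbove) ∪ Set.range (cexp ∘ (z ∘ p.succAbove)))) ∨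
        (2 : Cardinal) ≤ Algebra.trdeg ℚ ↥(adjoin ℚ
          (Set.range (z ∘ (p.succAbove q).succAbove) ∪
            Set.range (cexp ∘ (z ∘ (p.succAbove q).succAbove)))) := by
    intro p q
    have hu := one_le_trdeg_of_ne_zero ((z ∘ p.succAbove) ∘ q.succAbove) 0 (hz _)
    have h2' : ((1 + 1 : ℕ) : Cardinal) ≤
        Algebra.trdeg ℚ ↥(adjoin ℚ (Set.range z ∪ Set.range (cexp ∘ z))) := by exact_mod_cast h2
    rcases face_exchange (n := 1) (m := 1) z p q hu h2' with h | h
    · exact Or.inl (by exact_mod_cast h)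
    · exact Or.inr (by exact_mod_cast h)
  fin_cases p₀
  · rcases key 1 1 with h | h
    · exact ⟨1, by decide, h⟩
    · exact ⟨(1 : Fin 3).succAbove 1, by decide, h⟩
  · rcases key 0 1 with h | h
    · exact ⟨0, by decide, h⟩
    · exact ⟨(0 : Fin 3).succAbove 1, by decide, h⟩
  · rcases key 0 0 with h | h
    · exact ⟨0, by decide, h⟩
    · exact ⟨(0 : Fin 3).succAbove 0, by decide, h⟩

/-- piece:proved · **PAIR REDUCTION OF THE DEFECT-ONE DEMAND AT n = 3.** For a triple with non-zero coordinates
the `S⁻`-demand `3 ≤ trdeg F_z + 1` holds iff SOME pair face of `z` is a Schanuel pair. -/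
theorem defectOneAt_three_iff (z : Fin 3 → ℂ) (hz : ∀ i, z i ≠ 0) :
    (3 : Cardinal) ≤ Algebra.trdeg ℚ ↥(adjoin ℚ (Set.range z ∪ Set.range (cexp ∘ z))) + 1 ↔
      ∃ p : Fin 3, (2 : Cardinal) ≤
        Algebra.trdeg ℚ ↥(adjoin ℚ (Set.range (z ∘ p.succAbove) ∪ Set.range (cexp ∘ (z ∘ p.succAbove)))) := by
  obtain ⟨t, ht, -⟩ := trdeg_eq_nat z
  constructor
  · intro h
    rw [ht] at h
    have h3 : 3 ≤ t + 1 := by exact_mod_cast h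
    have h2 : (2 : Cardinal) ≤ Algebra.trdeg ℚ ↥(adjoin ℚ (Set.range z ∪ Set.range (cexp ∘ z))) := by
      rw [ht]
      exact_mod_cast (show 2 ≤ t by omega)
    obtain ⟨p, -, hp⟩ := two_faces_of_two_le_trdeg z hz h2 0
    exact ⟨p, hp⟩
  · rintro ⟨p, hp⟩
    have hle := hp.trans (trdeg_face_le z p)
    rw [ht] at hle ⊢
    have h2 : 2 ≤ t := by exact_mod_cast hle
    exact_mod_cast (show 3 ≤ t + 1 by omega)

/-- piece:proved · under `S⁻` (stmt-25020) every ℚ-free triple has, away from any prescribed index, a Schanuel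
pair face — so at least two of its three pairs `(z_i, z_j)` have `trdeg ℚ(z_i, z_j, e^{z_i}, e^{z_j}) ≥ 2`. -/
theorem two_schanuel_faces_of_defectOne (hD : DefectOneSchanuel) (z : Fin 3 → ℂ)
    (hz : LinearIndependent ℚ z) (p₀ : Fin 3) :
    ∃ p : Fin 3, p ≠ p₀ ∧ (2 : Cardinal) ≤
      Algebra.trdeg ℚ ↥(adjoin ℚ (Set.range (z ∘ p.succAbove) ∪ Set.range (cexp ∘ (z ∘ p.succAbove)))) := by
  have hne : ∀ i, z i ≠ 0 := fun i => hz.ne_zero i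
  obtain ⟨t, ht, -⟩ := trdeg_eq_nat z
  have h := hD 3 z hz
  rw [ht] at h
  have h3 : 3 ≤ t + 1 := by exact_mod_cast h
  have h2 : (2 : Cardinal) ≤ Algebra.trdeg ℚ ↥(adjoin ℚ (Set.range z ∪ Set.range (cexp ∘ z))) := by
    rw [ht]
    exact_mod_cast (show 2 ≤ t by omega)
  exact two_faces_of_two_le_trdeg z hne h2 p₀

/-- piece:proved · **MEMBER DECODING (sharp form).** If `c ≠ 0`, the defect-one demand at `(a, b, c)` — the
conclusion of `PlainDefectOne` (stmt-31410) / `DefectOneSchanuel` (stmt-25020) at `n = 3` — forces a Schanuel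
PAIR among the two pair faces THROUGH `c`:  `2 ≤ trdeg ℚ(b, c, e^b, e^c)` or `2 ≤ trdeg ℚ(a, c, e^a, e^c)`. -/
theorem triple_demand_faces_through (a b c : ℂ) (hc : c ≠ 0)
    (h : (3 : Cardinal) ≤ Algebra.trdeg ℚ ↥(adjoin ℚ (Set.range (![a, b, c] : Fin 3 → ℂ) ∪
      Set.range (cexp ∘ (![a, b, c] : Fin 3 → ℂ)))) + 1) :
    (2 : Cardinal) ≤ Algebra.trdeg ℚ ↥(adjoin ℚ (Set.range (![b, c] : Fin 2 → ℂ) ∪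
        Set.range (cexp ∘ (![b, c] : Fin 2 → ℂ)))) ∨
      (2 : Cardinal) ≤ Algebra.trdeg ℚ ↥(adjoin ℚ (Set.range (![a, c] : Fin 2 → ℂ) ∪
        Set.range (cexp ∘ (![a, c] : Fin 2 → ℂ)))) := by
  obtain ⟨t, ht, -⟩ := trdeg_eq_nat (![a, b, c] : Fin 3 → ℂ)
  rw [ht] at h
  have h3 : 3 ≤ t + 1 := by exact_mod_cast h
  have h2 : ((1 + 1 : ℕ) : Cardinal) ≤ Algebra.trdeg ℚ ↥(adjoin ℚ (Set.range (![a, b, c] : Fin 3 → ℂ) ∪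
      Set.range (cexp ∘ (![a, b, c] : Fin 3 → ℂ)))) := by
    rw [ht]
    exact_mod_cast (show 2 ≤ t by omega)
  have hu := one_le_trdeg_of_ne_zero
    (((![a, b, c] : Fin 3 → ℂ) ∘ (0 : Fin 3).succAbove) ∘ (0 : Fin 2).succAbove) 0 hc
  have e : ((1 + 1 : ℕ) : Cardinal) = 2 := by norm_num
  rcases face_exchange (n := 1) (m := 1) (![a, b, c] : Fin 3 → ℂ) 0 0 hu h2 with h' | h'
  · left
    rw [e] at h'
    refine h'.trans (trdeg_le_of_mem_span fun j => ?_)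
    fin_cases j
    · exact Submodule.subset_span ⟨0, rfl⟩
    · exact Submodule.subset_span ⟨1, rfl⟩
  · right
    rw [e] at h'
    refine h'.trans (trdeg_le_of_mem_span fun j => ?_)
    fin_cases j
    · exact Submodule.subset_span ⟨0, rfl⟩
    · exact Submodule.subset_span ⟨1, rfl⟩

/-- piece:proved · **MEMBER DECODING.** For `c ≠ 0` the defect-one demand at the triple `(a, b, c)` is LITERALLY
the disjunction of the Schanuel PAIR CELLS of its three faces (and already of the two through `c`). In
particular every `n = 3` member demand of the plain class 31410 — e.g. the ELogPlane members `(1, ℓ₁, ℓ₂)`,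
`M₁ = (1, iπ, log 2)`, `M₂ = (1, log 2, log 3)` — is a disjunction of `S₂`-instances of its faces. -/
theorem triple_demand_iff (a b c : ℂ) (hc : c ≠ 0) :
    (3 : Cardinal) ≤ Algebra.trdeg ℚ ↥(adjoin ℚ (Set.range (![a, b, c] : Fin 3 → ℂ) ∪
        Set.range (cexp ∘ (![a, b, c] : Fin 3 → ℂ)))) + 1 ↔
      (2 : Cardinal) ≤ Algebra.trdeg ℚ ↥(adjoin ℚ (Set.range (![b, c] : Fin 2 → ℂ) ∪
          Set.range (cexp ∘ (![b, c] : Fin 2 → ℂ)))) ∨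
        (2 : Cardinal) ≤ Algebra.trdeg ℚ ↥(adjoin ℚ (Set.range (![a, c] : Fin 2 → ℂ) ∪
          Set.range (cexp ∘ (![a, c] : Fin 2 → ℂ)))) ∨
        (2 : Cardinal) ≤ Algebra.trdeg ℚ ↥(adjoin ℚ (Set.range (![a, b] : Fin 2 → ℂ) ∪
          Set.range (cexp ∘ (![a, b] : Fin 2 → ℂ)))) := by
  constructor
  · intro h
    rcases triple_demand_faces_through a b c hc h with h' | h'
    · exact Or.inl h'
    · exact Or.inr (Or.inl h')
  · obtain ⟨t, ht, -⟩ := trdeg_eq_nat (![a, b, c] : Fin 3 → ℂ)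
    have fin : ∀ {w : Fin 2 → ℂ}, (∀ j, w j ∈ Submodule.span ℚ (Set.range (![a, b, c] : Fin 3 → ℂ))) →
        (2 : Cardinal) ≤ Algebra.trdeg ℚ ↥(adjoin ℚ (Set.range w ∪ Set.range (cexp ∘ w))) →
        (3 : Cardinal) ≤ Algebra.trdeg ℚ ↥(adjoin ℚ (Set.range (![a, b, c] : Fin 3 → ℂ) ∪
          Set.range (cexp ∘ (![a, b, c] : Fin 3 → ℂ)))) + 1 := by
      intro w hw hw2
      have hle := hw2.trans (trdeg_le_of_mem_span hw)
      rw [ht] at hle ⊢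
      have : 2 ≤ t := by exact_mod_cast hle
      exact_mod_cast (show 3 ≤ t + 1 by omega)
    rintro (h | h | h)
    · refine fin (fun j => ?_) h
      fin_cases j
      · exact Submodule.subset_span ⟨1, rfl⟩
      · exact Submodule.subset_span ⟨2, rfl⟩
    · refine fin (fun j => ?_) h
      fin_cases j
      · exact Submodule.subset_span ⟨0, rfl⟩
      · exact Submodule.subset_span ⟨2, rfl⟩
    · refine fin (fun j => ?_) h
      fin_cases j
      · exact Submodule.subset_span ⟨0, rfl⟩
      · exact Submodule.subset_span ⟨1, rfl⟩

/-- piece:proved · **AN UNCONDITIONAL INSTANCE (Lindemann–Weierstrass + face exchange).** For algebraic `α, β`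
ℚ-free and ANY `t ≠ 0`, one of the pairs `(β, t)`, `(α, t)` is a Schanuel pair:
`2 ≤ trdeg ℚ(β, t, e^β, e^t)` or `2 ≤ trdeg ℚ(α, t, e^α, e^t)`.  Example `(α, β, t) = (1, √2, iπ)`:
`π` is algebraically independent from `e` OR from `e^{√2}` — each disjunct alone is an open `S₂`-instance. -/
theorem lw_pair_through (α β t : ℂ) (hα : IsAlgebraic ℚ α) (hβ : IsAlgebraic ℚ β)
    (hli : LinearIndependent ℚ ![α, β]) (ht : t ≠ 0) :
    (2 : Cardinal) ≤ Algebra.trdeg ℚ ↥(adjoin ℚ (Set.range (![β, t] : Fin 2 → ℂ) ∪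
        Set.range (cexp ∘ (![β, t] : Fin 2 → ℂ)))) ∨
      (2 : Cardinal) ≤ Algebra.trdeg ℚ ↥(adjoin ℚ (Set.range (![α, t] : Fin 2 → ℂ) ∪
        Set.range (cexp ∘ (![α, t] : Fin 2 → ℂ)))) := by
  apply triple_demand_faces_through α β t ht
  have halg : ∀ i, IsAlgebraic ℚ ((![α, β] : Fin 2 → ℂ) i) := by
    intro i
    fin_cases i
    · exact hα
    · exact hβ
  have hmem : ∀ i, IsAlgebraic ↥(adjoin ℚ (Set.range (![α, β, t] : Fin 3 → ℂ) ∪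
      Set.range (cexp ∘ (![α, β, t] : Fin 3 → ℂ)))) (cexp ((![α, β] : Fin 2 → ℂ) i)) := by
    intro i
    refine isAlgebraic_of_mem_adjoin (subset_adjoin ℚ _ (Or.inr ?_))
    fin_cases i
    · exact ⟨0, rfl⟩
    · exact ⟨1, rfl⟩
  have h2 := two_le_trdeg_of_algebraicIndependent_of_isAlgebraic (![α, β, t] : Fin 3 → ℂ)
    (algebraicIndependent_exp_holds (![α, β] : Fin 2 → ℂ) halg hli) hmem
  obtain ⟨s, hs, -⟩ := trdeg_eq_nat (![α, β, t] : Fin 3 → ℂ)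
  rw [hs] at h2 ⊢
  have : 2 ≤ s := by exact_mod_cast h2
  exact_mod_cast (show 3 ≤ s + 1 by omega)

/-! ## §4c The exceptional line of a pair-cell family (unconditional) -/

/-- piece:proved · For `t ≠ 0`, two algebraic numbers whose pairs with `t` BOTH fail to be Schanuel pairs are
ℚ-linearly dependent (contrapositive of `lw_pair_through`). -/
theorem lw_exceptions_dependent (t : ℂ) (ht : t ≠ 0) {α β : ℂ} (hα : IsAlgebraic ℚ α)
    (hβ : IsAlgebraic ℚ β)
    (hαt : ¬ (2 : Cardinal) ≤ Algebra.trdeg ℚ ↥(adjoin ℚ (Set.range (![α, t] : Fin 2 → ℂ) ∪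
        Set.range (cexp ∘ (![α, t] : Fin 2 → ℂ)))))
    (hβt : ¬ (2 : Cardinal) ≤ Algebra.trdeg ℚ ↥(adjoin ℚ (Set.range (![β, t] : Fin 2 → ℂ) ∪
        Set.range (cexp ∘ (![β, t] : Fin 2 → ℂ))))) :
    ¬ LinearIndependent ℚ ![α, β] := fun hli => by
  rcases lw_pair_through α β t hα hβ hli ht with h | h
  · exact hβt h
  · exact hαt h

/-- piece:proved · **THE EXCEPTIONAL LINE.** For every `t ≠ 0` there is `γ` such that EVERY algebraic `α` off the
ℚ-line `ℚ∙γ` gives a Schanuel pair `(α, t)`: `2 ≤ trdeg ℚ(α, t, e^α, e^t)` (= `trdeg ℚ(t, e^t, e^α)`).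
Instances: `t = iπ` — `π` and `e^α` are algebraically independent for all algebraic `α` outside ONE ℚ-line;
`t = log 2` — `log 2` and `e^α` likewise.  (Whether `α = 1` is on the exceptional line of `iπ`, i.e. whether
`e` and `π` are algebraically independent, is the open pair cell `S₂(1, iπ)`.) -/
theorem lw_exceptional_line (t : ℂ) (ht : t ≠ 0) :
    ∃ γ : ℂ, ∀ α : ℂ, IsAlgebraic ℚ α → α ∉ Submodule.span ℚ ({γ} : Set ℂ) →
      (2 : Cardinal) ≤ Algebra.trdeg ℚ ↥(adjoin ℚ (Set.range (![α, t] : Fin 2 → ℂ) ∪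
        Set.range (cexp ∘ (![α, t] : Fin 2 → ℂ)))) := by
  by_cases hex : ∃ α₀ : ℂ, α₀ ≠ 0 ∧ IsAlgebraic ℚ α₀ ∧
      ¬ (2 : Cardinal) ≤ Algebra.trdeg ℚ ↥(adjoin ℚ (Set.range (![α₀, t] : Fin 2 → ℂ) ∪
        Set.range (cexp ∘ (![α₀, t] : Fin 2 → ℂ))))
  · obtain ⟨α₀, h0, hα₀, hα₀t⟩ := hex
    refine ⟨α₀, fun α hα hαγ => ?_⟩
    by_contra hαt
    refine lw_exceptions_dependent t ht hα₀ hα hα₀t hαt ?_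
    rw [LinearIndependent.pair_iff]
    intro s r h
    by_cases hr : r = 0
    · subst hr
      simp only [zero_smul, add_zero, smul_eq_zero] at h
      exact ⟨h.resolve_right h0, rfl⟩
    · exfalso
      apply hαγ
      have h1 : r • α = -(s • α₀) := eq_neg_of_add_eq_zero_right h
      have h2 : α = r⁻¹ • (r • α) := by rw [smul_smul, inv_mul_cancel₀ hr, one_smul]
      rw [h1, smul_neg, smul_smul, ← neg_smul] at h2
      rw [h2]
      exact Submodule.smul_mem _ _ (Submodule.mem_span_singleton_self α₀)
  · refine ⟨0, fun α hα hαγ => ?_⟩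
    by_contra hαt
    by_cases hα0 : α = 0
    · subst hα0
      exact hαγ (Submodule.zero_mem _)
    · exact hex ⟨α, hα0, hα, hαt⟩

/-! ## §4d A plain member of Hermite–Lindemann shape, decoded: `(1, π², π³)` -/

/-- `π` is transcendental as a complex number (tree fact `transcendental_pi_holds`). -/
private theorem transcendental_pi_complex : Transcendental ℚ (Real.pi : ℂ) := fun h =>
  transcendental_pi_holds ((isAlgebraic_algebraMap_iff (A := ℂ) Complex.ofReal_injective).mp h)

/-- piece:proved · If `a + b π² + c π³` (`a, b, c ∈ ℚ`) is algebraic then `b = c = 0`: otherwise `π` is a root of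
`q ∘ (a + bX² + cX³) ≠ 0` for an annihilating polynomial `q` of that algebraic number. -/
theorem pi_cubic_coeffs_zero (a b c : ℚ)
    (h : IsAlgebraic ℚ ((a : ℂ) + (b : ℂ) * (Real.pi : ℂ) ^ 2 + (c : ℂ) * (Real.pi : ℂ) ^ 3)) :
    b = 0 ∧ c = 0 := by
  by_contra hbc
  apply transcendental_pi_complex
  obtain ⟨q, hq0, hq⟩ := h
  let r : ℚ[X] := C a + C b * X ^ 2 + C c * X ^ 3
  have hr : aeval (Real.pi : ℂ) r = (a : ℂ) + (b : ℂ) * (Real.pi : ℂ) ^ 2 + (c : ℂ) * (Real.pi : ℂ) ^ 3 := by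
    simp [r]
  refine ⟨q.comp r, fun h0 => ?_, by rw [aeval_comp, hr, hq]⟩
  rcases comp_eq_zero_iff.1 h0 with h1 | ⟨-, h1⟩
  · exact hq0 h1
  · apply hbc
    have h2 := congrArg (fun f : ℚ[X] => f.coeff 2) h1
    have h3 := congrArg (fun f : ℚ[X] => f.coeff 3) h1
    simp [r] at h2 h3
    exact ⟨h2, h3⟩

/-- piece:proved · `(1, π², π³)` is ℚ-free. -/
theorem piPowers_linearIndependent :
    LinearIndependent ℚ (![1, (Real.pi : ℂ) ^ 2, (Real.pi : ℂ) ^ 3] : Fin 3 → ℂ) := by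
  rw [Fintype.linearIndependent_iff]
  intro g hg
  simp [Fin.sum_univ_three, Rat.smul_def] at hg
  have halg : IsAlgebraic ℚ ((g 0 : ℂ) + (g 1 : ℂ) * (Real.pi : ℂ) ^ 2 + (g 2 : ℂ) * (Real.pi : ℂ) ^ 3) := by
    rw [hg]
    exact isAlgebraic_zero
  obtain ⟨h1, h2⟩ := pi_cubic_coeffs_zero _ _ _ halg
  rw [h1, h2] at hg
  simp at hg
  intro i
  fin_cases i
  · exact hg
  · exact h1
  · exact h2

/-- piece:proved · `(1, π², π³)` is PLAIN: its ℚ-span meets `ℚ̄` only in `ℚ` (the multiplier form used by 31410). -/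
theorem piPowers_plain : ∀ β : ℂ, IsAlgebraic ℚ β →
    (∀ i, β * (![1, (Real.pi : ℂ) ^ 2, (Real.pi : ℂ) ^ 3] : Fin 3 → ℂ) i ∈
      Submodule.span ℚ (Set.range (![1, (Real.pi : ℂ) ^ 2, (Real.pi : ℂ) ^ 3] : Fin 3 → ℂ))) →
    β ∈ Set.range (algebraMap ℚ ℂ) := by
  intro β hβ hmul
  have h1 := hmul 0
  simp only [Matrix.cons_val_zero, mul_one] at h1
  obtain ⟨g, hg⟩ := (Submodule.mem_span_range_iff_exists_fun ℚ).1 h1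
  simp [Fin.sum_univ_three, Rat.smul_def] at hg
  have halg : IsAlgebraic ℚ ((g 0 : ℂ) + (g 1 : ℂ) * (Real.pi : ℂ) ^ 2 + (g 2 : ℂ) * (Real.pi : ℂ) ^ 3) := by
    rw [hg]
    exact hβ
  obtain ⟨hb, hc⟩ := pi_cubic_coeffs_zero _ _ _ halg
  rw [hb, hc] at hg
  simp at hg
  exact ⟨g 0, by rw [← hg]; simp⟩

/-- piece:proved · **A MEMBER OF H–L SHAPE, DECODED.** `(1, π², π³)` is a member of the plain class 31410 at its
first open length — ℚ-free (`piPowers_linearIndependent`), plain (`piPowers_plain`), sub-tuples free of charge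
(the tree's `RootDecomp1EModuleGrids.subMinimal_three`), certified by the transcendence of `π` alone (no logarithm of an algebraic number, no
Lindemann–Weierstrass family, no Nesterenko pair) — and `PlainDefectOne` specialises at it to the bare demand,
which `triple_demand_iff` DECODES into the pair cells `S₂(π², π³) ∨ S₂(1, π³) ∨ S₂(1, π²)`, i.e.
«two of `π, e^{π²}, e^{π³}` are algebraically independent, or `e ⊥ {π, e^{π³}}`-wise: `2 ≤ trdeg ℚ(π³, e, e^{π³})`,
or `2 ≤ trdeg ℚ(π², e, e^{π²})`» — a disjunction of `S₂`-instances, none implied by AIL, none decided. -/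
theorem piPowers_member_decoded (hP : PlainDefectOne) :
    (2 : Cardinal) ≤ Algebra.trdeg ℚ ↥(adjoin ℚ (Set.range (![(Real.pi : ℂ) ^ 2, (Real.pi : ℂ) ^ 3] : Fin 2 → ℂ) ∪
        Set.range (cexp ∘ (![(Real.pi : ℂ) ^ 2, (Real.pi : ℂ) ^ 3] : Fin 2 → ℂ)))) ∨
      (2 : Cardinal) ≤ Algebra.trdeg ℚ ↥(adjoin ℚ (Set.range (![1, (Real.pi : ℂ) ^ 3] : Fin 2 → ℂ) ∪
        Set.range (cexp ∘ (![1, (Real.pi : ℂ) ^ 3] : Fin 2 → ℂ)))) ∨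
      (2 : Cardinal) ≤ Algebra.trdeg ℚ ↥(adjoin ℚ (Set.range (![1, (Real.pi : ℂ) ^ 2] : Fin 2 → ℂ) ∪
        Set.range (cexp ∘ (![1, (Real.pi : ℂ) ^ 2] : Fin 2 → ℂ)))) := by
  have hπ : (Real.pi : ℂ) ^ 3 ≠ 0 := pow_ne_zero 3 (Complex.ofReal_ne_zero.2 Real.pi_ne_zero)
  exact (triple_demand_iff 1 _ _ hπ).1
    (hP 3 _ piPowers_linearIndependent piPowers_plain (Summit.Schanuel.Schanuel.Theorems.RootDecomp1EModuleGrids.subMinimal_three _))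

/-! ## §5 The route's deciding theorem through `𝓗` -/

/-- `closes` of this node: the LIVE 7-binder `RootDecomp1E.closes`, its first binder `DefectOneSchanuel`
(stmt-25020) supplied by HYPERPLANE SCHANUEL through §3. -/
theorem closes (hH : HyperplaneSchanuel) (hC : ClosedFormAtomSchanuel) (hAlg : AlgAnchoredDarkAtomSchanuel)
    (hLine : LineLogDarkAtomSchanuel) (hDeep : DeepLogDarkAtomSchanuel) (hOff : OffAxisClosure)
    (hF : FreeDarkAtomSchanuel) : _root_.Schanuel :=
  Summit.Schanuel.Schanuel.Theses.RootDecomp1E.closes (defectOne_of_hyperplaneSchanuel hH) hC hAlg hLine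
    hDeep hOff hF

end Summit.Schanuel.Schanuel.Theorems.RootDecomp1EHyperplane

end
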